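import Mathlib

/-!
# Crux `UniformPhotonSphereChannelsR` (K1R, stmt-FinalStateConjecture-14074), line
# `crum-peeling-recessive-tower` — Theorem A support: the inversion majorant

For the coefficient arrays of skeleton v4 (`g_k = Σ G k n wⁿ`, `ω_k = 1/g_k = Σ Ω k n wⁿ`, inversion
relation `Σ_{i ≤ n} G i · Ω (n−i) = [n = 0]`), the bounds of `stub_coeffMajorant` on ONE rung of `G`
(`G 0 = 1`, `|G 1| ≤ R`, `|G n| ≤ R^{n−1}` for `n ≥ 2`, `R ≥ 1`) give `|Ω n| ≤ (2R)ⁿ` for the inverse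
series: the last clause of `stub_coeffMajorant` follows from the first two (with `R ↦ 2R`, which the
exported constant `K` absorbs).  Proof: `Ω n = −Σ_{i<n} G (i+1) Ω (n−1−i)` and, by strong induction,
`|G (i+1)| |Ω (n−1−i)| ≤ R^{i+1} (2R)^{n−1−i} = 2^{−(i+1)} (2R)ⁿ`, whose sum over `i < n` is `< (2R)ⁿ`.
-/

-- `Summit.<S>.<S>` repeats a namespace component by design (D-0017); off here as in the lakefile.
set_option linter.dupNamespace false

noncomputable section

open Finset

namespace Summit.FinalStateConjecture.FinalStateConjecture.Theorems.CrumPeelingRecessiveTower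

/-- **Inversion majorant** (registered sub-goal `coeffMajorant_inversion` of `stub_coeffMajorant`,
verbatim signature).  If `G 0 = 1`, `|G 1| ≤ R`, `|G n| ≤ R^{n−1}` (`n ≥ 2`), `R ≥ 1`, and `Ω` is the
inverse series (`Σ_{i ≤ n} G i · Ω (n−i) = [n = 0]`), then `|Ω n| ≤ (2R)ⁿ`. -/
theorem coeffMajorant_inversion : ∀ (R : ℝ) (G Ω : ℕ → ℝ), 1 ≤ R → G 0 = 1 → |G 1| ≤ R → (∀ n, 2 ≤ n → |G n| ≤ R ^ (n - 1)) → (∀ n, ∑ i ∈ Finset.range (n + 1), G i * Ω (n - i) = if n = 0 then 1 else 0) → ∀ n, |Ω n| ≤ (2 * R) ^ n := by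
  intro R G Ω hR hG0 hG1 hGn hinv
  have hR0 : 0 < R := by linarith
  -- the weak uniform bound `|G m| ≤ R^m` for `m ≥ 1`
  have hGw : ∀ m, 1 ≤ m → |G m| ≤ R ^ m := by
    intro m hm
    rcases Nat.lt_or_ge m 2 with h | h
    · obtain rfl : m = 1 := by omega
      simpa using hG1
    · exact (hGn m h).trans (pow_le_pow_right₀ hR (Nat.sub_le m 1))
  -- `Ω 0 = 1`
  have hΩ0 : Ω 0 = 1 := by
    have h := hinv 0
    simpa [hG0] using h
  -- `Ω n = −Σ_{i<n} G (i+1) Ω (n−(i+1))` for `n ≥ 1`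
  have hrec : ∀ n, 1 ≤ n → Ω n = -∑ i ∈ range n, G (i + 1) * Ω (n - (i + 1)) := by
    intro n hn
    have h := hinv n
    rw [if_neg (by omega), sum_range_succ'] at h
    simp only [Nat.sub_zero, hG0, one_mul] at h
    linarith
  -- strong induction
  intro n
  induction n using Nat.strong_induction_on with
  | _ n ih =>
    rcases Nat.eq_zero_or_pos n with rfl | hn
    · simp [hΩ0]
    · rw [hrec n hn, abs_neg]
      have hterm : ∀ i ∈ range n,
          |G (i + 1) * Ω (n - (i + 1))| ≤ (1 / 2) ^ (i + 1) * (2 * R) ^ n := by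
        intro i hi
        have hi' : i < n := mem_range.1 hi
        rw [abs_mul]
        have h1 : |G (i + 1)| ≤ R ^ (i + 1) := hGw (i + 1) (by omega)
        have h2 : |Ω (n - (i + 1))| ≤ (2 * R) ^ (n - (i + 1)) := ih _ (by omega)
        calc |G (i + 1)| * |Ω (n - (i + 1))| ≤ R ^ (i + 1) * (2 * R) ^ (n - (i + 1)) :=
              mul_le_mul h1 h2 (abs_nonneg _) (pow_nonneg hR0.le _)
          _ = (1 / 2) ^ (i + 1) * (2 * R) ^ n := by
              have hsplit : (2 * R) ^ n = (2 * R) ^ (i + 1) * (2 * R) ^ (n - (i + 1)) := by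
                rw [← pow_add, Nat.add_sub_cancel' (by omega)]
              rw [hsplit, ← mul_assoc]
              congr 1
              rw [mul_pow, ← mul_assoc, ← mul_pow]
              norm_num
      calc |∑ i ∈ range n, G (i + 1) * Ω (n - (i + 1))|
          ≤ ∑ i ∈ range n, |G (i + 1) * Ω (n - (i + 1))| := abs_sum_le_sum_abs _ _
        _ ≤ ∑ i ∈ range n, (1 / 2) ^ (i + 1) * (2 * R) ^ n := sum_le_sum hterm
        _ = ((1 / 2) * ∑ i ∈ range n, (1 / 2 : ℝ) ^ i) * (2 * R) ^ n := by
            rw [mul_sum, sum_mul]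
            refine sum_congr rfl fun i _ => ?_
            rw [pow_succ]
            ring
        _ ≤ ((1 / 2) * 2) * (2 * R) ^ n := by
            refine mul_le_mul_of_nonneg_right ?_ (pow_nonneg (by linarith) _)
            exact mul_le_mul_of_nonneg_left (sum_geometric_two_le n) (by norm_num)
        _ = (2 * R) ^ n := by ring

end Summit.FinalStateConjecture.FinalStateConjecture.Theorems.CrumPeelingRecessiveTower

end
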